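import Summits.QuantumFields.YangMills.Theorems.VirialFluxGapRingOrbitSeparation
import Literature.MathematicalPhysics.QuantumFieldTheory.Balaban1983to89.T4HaarSU2ExpChart
import Literature.MathematicalPhysics.QuantumFieldTheory.Balaban1983to89.T4WilsonLinkAffine
import Literature.MathematicalPhysics.QuantumLattice.SU2HaarSmallBall
import HarnessLib

/-!
# The TWO-ANCHOR SLICE PROPERTY (global in the group variable): `hslice` of the orbit-tube theorem from pure quaternion algebra
# (layer (B2) of the DIRECT Laplace road to ⟨stmt-QuantumFields-24204⟩ `VirialFluxGap.SharpTwistedLaplace`)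

Helper module (free-hands work of width seat ym-line-sfw-p2-w3 g57, cell ym-idea-1; `--supports 24204`).  The residual symmetry of the tree-gauged
ring space `X_fix` is the CONSTANT `SU(2)` acting by conjugation (✓`VirialFluxGapFixGaugeAction`), and the critical orbits are `SU(2)·Q_s`
(✓`ringDeficit_treeGauge_eq_zero_iff`).  A slice chart for ✓`QuantitativeLaplace.laplaceMethod_quantitative_orbit_tube` needs the SLICE PROPERTY
`hslice`: «`k·σ(y) = σ(y')` with `y, y'` in the window forces `k ∈ {±1}`».  We decide it on TWO ANCHOR COMPONENTS of `Q_s` only — the seam site `0`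
(value `C₀`, a pure unit quaternion `n_C`) and the wrapping link `e₀` of slice `0` (value `±N₀`, a pure unit quaternion `±n_N ⊥ n_C`) — with the
COORDINATE slice «`e^{t n_C}·C₀` at the seam anchor (`t ∈ ℝ`), `e^{b}·N₀` with `b ∈ span(n_N, n_C n_N) = n_C^⊥` at the link anchor»:

* §1 quaternion lemmas (pure quaternions: `p q + q p = −2⟪p,q⟫`, `star p = −p`; a unit `k` commuting with a pure unit `n` is
  `k = re k + ⟪k,n⟫·n`; the conjugation formula `(α + βn_C) n_N (α + βn_C)* = (α² − β²) n_N + 2αβ n_C n_N`);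
* §2 ★ `eq_one_or_neg_one_of_conj_anchors` — THE CORE: `‖k‖ = 1`, `k n_C = n_C k`, and `k (y₀ + y_C n_C + y_N n_N) k* = y₀' + y_C' n_C + y_N' n_N`
  with `y_N·y_N' > 0` force `k = ±1` (take `⟪·, n_C n_N⟫` and `⟪·, n_N⟫`: `αβ = 0`, `α² − β² > 0`);
* §3 the anchors in exponential coordinates: `e^{ι(tω_C)} ι ω_C = −sin t + cos t · ιω_C` (`exp_smul_mul_self`), and for `b = b₁ω_N + b₂ω_×` with
  `ι ω_× = ιω_C ιω_N`: `e^{ι b} ιω_N = −sinc‖b‖ b₁ − sinc‖b‖ b₂ · ιω_C + cos‖b‖ · ιω_N` (`exp_perp_mul_anchor`); `commute_of_conj_seam_anchor`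
  (the seam-anchor equation alone forces `k n_C = n_C k`);
* §4 ★★ `eq_one_or_neg_one_of_conj_anchor_pair` (quaternions) and ★★ `su2_eq_one_or_negOne_of_conj_anchor_pair` (`SU2`, via `su2Quat`): the two
  anchor equations with `|t|, |t'| < π/2` and `b₁² + b₂², b₁'² + b₂'² < (π/2)²` force `k = ±1`.  The radius is `O(1)` (no `L`).

Everything here is PROVED; no definitions, no named facts (namespace `Summit.QuantumFields.YangMills.Theorems.VirialFluxGap.AnchorSlice`).
HONEST FRAMING: elementary algebra; ⟨24204⟩, ⟨24319⟩ and every rung stay OPEN; the Yang–Mills mass gap (Clay) is NOT touched; no summit is proved by a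
line.

## References
* A. González-Arroyo, C. P. Korthals Altes, Nucl. Phys. B311 (1988), §2 (twist eaters and their finite stabilisers). [GonzalezarroyoAltes1988]
* G. E. Bredon, *Introduction to Compact Transformation Groups* (1972), Ch. II §§4–5 (slices). [Bredon1972]
-/

set_option autoImplicit false

noncomputable section

open scoped Quaternion RealInnerProductSpace
open NormedSpace
open Literature.MathematicalPhysics.QuantumFieldTheory hiding SU2
open Literature.MathematicalPhysics.QuantumLattice
open Literature.MathematicalPhysics.QuantumFieldTheory.Balaban1983to89.T4WilsonGaugeFlatDirection (su2Quat_injective)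
open Literature.MathematicalPhysics.QuantumFieldTheory.Balaban1983to89.T4WilsonLinkAffine (su2Quat_inv)
open Literature.MathematicalPhysics.QuantumFieldTheory.Balaban1983to89.T4HaarSU2ExpChart
open Summit.QuantumFields.YangMills.Theorems.FemtoTransferGap
open Summit.QuantumFields.YangMills.Theorems.FemtoTransferGap.TT

namespace Summit.QuantumFields.YangMills.Theorems.VirialFluxGap.AnchorSlice

/-! ## §1 Quaternion lemmas -/

/-- Pure quaternions anticommute up to their inner product: `p q + q p = −2⟪p, q⟫`. [folklore] -/
theorem pure_mul_add_mul (p q : ℍ) (hp : p.re = 0) (hq : q.re = 0) :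
    p * q + q * p = ((-2 * ⟪p, q⟫ : ℝ) : ℍ) := by
  have hinner : ⟪p, q⟫ = p.re * q.re + p.imI * q.imI + p.imJ * q.imJ + p.imK * q.imK := by
    rw [Quaternion.inner_def]; simp
  ext <;> simp [hp, hq, hinner] <;> ring

/-- `star p = −p` for a pure quaternion. [folklore] -/
theorem star_eq_neg_of_pure {p : ℍ} (hp : p.re = 0) : star p = -p := by
  ext <;> simp [hp]

/-- Orthogonal pure quaternions anticommute. [folklore] -/
theorem mul_eq_neg_mul_of_pure_orth {p q : ℍ} (hp : p.re = 0) (hq : q.re = 0) (hpq : ⟪p, q⟫ = 0) :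
    q * p = -(p * q) := by
  have := pure_mul_add_mul p q hp hq
  rw [hpq, mul_zero] at this
  have h0 : p * q + q * p = 0 := by rw [this]; simp
  exact eq_neg_of_add_eq_zero_right h0

/-- The real part of a product of pure quaternions is minus their inner product. [folklore] -/
theorem re_pure_mul_pure {p q : ℍ} (hp : p.re = 0) (hq : q.re = 0) : (p * q).re = -⟪p, q⟫ := by
  rw [Quaternion.inner_def]; simp [hp, hq]; ring

/-- `⟪p q, p⟫ = 0` for pure `p, q`. [folklore] -/
theorem inner_pure_mul_left {p q : ℍ} (hp : p.re = 0) (hq : q.re = 0) : ⟪p * q, p⟫ = 0 := by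
  rw [Quaternion.inner_def]; simp [hp, hq]; ring

/-- `⟪p q, q⟫ = 0` for pure `p, q`. [folklore] -/
theorem inner_pure_mul_right {p q : ℍ} (hp : p.re = 0) (hq : q.re = 0) : ⟪p * q, q⟫ = 0 := by
  rw [Quaternion.inner_def]; simp [hp, hq]; ring

/-- **A quaternion commuting with a pure unit quaternion `n` lies in `span(1, n)`: `k = re k + ⟪k, n⟫·n`.** [folklore] -/
theorem eq_re_add_inner_smul_of_commute {k n : ℍ} (hn0 : n.re = 0) (hn1 : ‖n‖ = 1) (hkn : k * n = n * k) :
    k = (k.re : ℍ) + ⟪k, n⟫ • n := by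
  have hns : n.imI ^ 2 + n.imJ ^ 2 + n.imK ^ 2 = 1 := by
    have := sq_norm_eq_sum_sq n; rw [hn1, hn0] at this; nlinarith [this]
  have hin : ⟪k, n⟫ = k.re * n.re + k.imI * n.imI + k.imJ * n.imJ + k.imK * n.imK := by
    rw [Quaternion.inner_def]; simp
  rw [hn0, mul_zero, zero_add] at hin
  have e1 := congrArg (fun q : ℍ => q.imI) hkn
  have e2 := congrArg (fun q : ℍ => q.imJ) hkn
  have e3 := congrArg (fun q : ℍ => q.imK) hkn
  simp [hn0] at e1 e2 e3
  have c1 : k.imJ * n.imK - k.imK * n.imJ = 0 := by linarith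
  have c2 : k.imK * n.imI - k.imI * n.imK = 0 := by linarith
  have c3 : k.imI * n.imJ - k.imJ * n.imI = 0 := by linarith
  ext <;> simp [hn0, hin]
  · linear_combination (-k.imI) * hns + n.imJ * c3 - n.imK * c2
  · linear_combination (-k.imJ) * hns + n.imK * c1 - n.imI * c3
  · linear_combination (-k.imK) * hns + n.imI * c2 - n.imJ * c1

/-- **Conjugation of `n_N` by `α + β n_C`** (`n_C ⊥ n_N` pure, `‖n_C‖ = 1`):
`(α + βn_C) n_N (α + βn_C)* = (α² − β²) n_N + 2αβ · n_C n_N` — rotation by the double angle in the plane `(n_N, n_C n_N)`. [folklore] -/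
theorem conj_pure_by_span {nC nN : ℍ} (hC0 : nC.re = 0) (hC1 : ‖nC‖ = 1) (hN0 : nN.re = 0)
    (hCN : ⟪nC, nN⟫ = 0) (α β : ℝ) :
    ((α : ℍ) + β • nC) * nN * star ((α : ℍ) + β • nC) = (α ^ 2 - β ^ 2) • nN + (2 * α * β) • (nC * nN) := by
  have h1 : nC * nC = -1 := by
    have hns : nC.re ^ 2 + nC.imI ^ 2 + nC.imJ ^ 2 + nC.imK ^ 2 = 1 := by rw [← sq_norm_eq_sum_sq, hC1]; norm_num
    ext <;> simp [hC0] <;> nlinarith [hns]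
  have h2 : nN * nC = -(nC * nN) := mul_eq_neg_mul_of_pure_orth hC0 hN0 hCN
  have h3 : nC * nN * nC = nN := by
    rw [mul_assoc, h2, mul_neg, ← mul_assoc, h1]; simp
  have hstar : star ((α : ℍ) + β • nC) = (α : ℍ) - β • nC := by
    rw [star_add, Quaternion.star_smul, star_eq_neg_of_pure hC0, Quaternion.star_coe]
    simp [sub_eq_add_neg]
  rw [hstar]
  have hα : (α : ℍ) = α • (1 : ℍ) := by rw [Algebra.smul_def, mul_one]; rfl
  rw [hα]
  simp only [add_mul, mul_sub, smul_mul_assoc, mul_smul_comm, one_mul, mul_one, h2, h3, mul_assoc]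
  module

/-! ## §2 The core: a unit commuting with `n_C` and conjugating one slice point to another is `±1` -/

/-- ★ **THE CORE OF THE TWO-ANCHOR SLICE PROPERTY.**  Let `n_C ⊥ n_N` be pure unit quaternions, `k` a unit quaternion commuting with `n_C`,
and suppose `k (y₀ + y_C n_C + y_N n_N) k* = y₀' + y_C' n_C + y_N' n_N` with `y_N y_N' > 0`.  Then `k = 1` or `k = −1`.
(Write `k = α + βn_C`; the `n_C n_N`-component of the conjugate is `2αβ y_N`, its `n_N`-component `(α² − β²) y_N`.)
[cite: GonzalezarroyoAltes1988, §2] [cite: Bredon1972, Ch. II §4] -/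
theorem eq_one_or_neg_one_of_conj_anchors {nC nN k : ℍ} (hC0 : nC.re = 0) (hC1 : ‖nC‖ = 1) (hN0 : nN.re = 0) (hN1 : ‖nN‖ = 1)
    (hCN : ⟪nC, nN⟫ = 0) (hk : ‖k‖ = 1) (hkC : k * nC = nC * k)
    {y₀ yC yN y₀' yC' yN' : ℝ} (hpos : 0 < yN * yN')
    (hconj : k * ((y₀ : ℍ) + yC • nC + yN • nN) * star k = (y₀' : ℍ) + yC' • nC + yN' • nN) :
    k = 1 ∨ k = -1 := by
  -- k = α + β nC
  set α := k.re with hαdef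
  set β := ⟪k, nC⟫ with hβdef
  have hkdec : k = (α : ℍ) + β • nC := eq_re_add_inner_smul_of_commute hC0 hC1 hkC
  have hnsC : nC.imI ^ 2 + nC.imJ ^ 2 + nC.imK ^ 2 = 1 := by
    have := sq_norm_eq_sum_sq nC; rw [hC1, hC0] at this; nlinarith [this]
  -- α² + β² = 1
  have hkI : k.imI = β * nC.imI := by
    have := congrArg (fun q : ℍ => q.imI) hkdec; simpa [hC0] using this
  have hkJ : k.imJ = β * nC.imJ := by
    have := congrArg (fun q : ℍ => q.imJ) hkdec; simpa [hC0] using this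
  have hkK : k.imK = β * nC.imK := by
    have := congrArg (fun q : ℍ => q.imK) hkdec; simpa [hC0] using this
  have hαβ : α ^ 2 + β ^ 2 = 1 := by
    have := sq_norm_eq_sum_sq k
    rw [hk, hkI, hkJ, hkK] at this
    linear_combination (-1 : ℝ) * this - β ^ 2 * hnsC
  -- the conjugated anchor
  have hkk : k * star k = 1 := by
    rw [Quaternion.self_mul_star k, Quaternion.normSq_eq_norm_mul_self, hk]; norm_num
  have hL : k * ((y₀ : ℍ) + yC • nC + yN • nN) * star k =
      (y₀ : ℍ) + yC • nC + yN • ((α ^ 2 - β ^ 2) • nN + (2 * α * β) • (nC * nN)) := by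
    have hcomm0 : k * ((y₀ : ℍ) + yC • nC) = ((y₀ : ℍ) + yC • nC) * k := by
      rw [mul_add, add_mul, Quaternion.coe_commutes, mul_smul_comm, smul_mul_assoc, hkC]
    have hconjN : k * nN * star k = (α ^ 2 - β ^ 2) • nN + (2 * α * β) • (nC * nN) := by
      rw [hkdec]; exact conj_pure_by_span hC0 hC1 hN0 hCN α β
    calc k * ((y₀ : ℍ) + yC • nC + yN • nN) * star k
        = k * ((y₀ : ℍ) + yC • nC) * star k + yN • (k * nN * star k) := by
          rw [mul_add, add_mul, mul_smul_comm, smul_mul_assoc]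
      _ = (y₀ : ℍ) + yC • nC + yN • ((α ^ 2 - β ^ 2) • nN + (2 * α * β) • (nC * nN)) := by
          rw [hcomm0, mul_assoc, hkk, mul_one, hconjN]
  rw [hL] at hconj
  -- inner products with n× = nC nN and with nN
  have hX0 : (nC * nN).re = 0 := by rw [re_pure_mul_pure hC0 hN0, hCN, neg_zero]
  have hX1 : ‖nC * nN‖ = 1 := by rw [norm_mul, hC1, hN1, mul_one]
  have i1 : ⟪nC, nC * nN⟫ = 0 := by rw [real_inner_comm]; exact inner_pure_mul_left hC0 hN0
  have i2 : ⟪nN, nC * nN⟫ = 0 := by rw [real_inner_comm]; exact inner_pure_mul_right hC0 hN0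
  have i3 : ⟪nC * nN, nC * nN⟫ = 1 := by rw [real_inner_self_eq_norm_sq, hX1]; norm_num
  have i4 : ⟪nN, nN⟫ = 1 := by rw [real_inner_self_eq_norm_sq, hN1]; norm_num
  have i5 : ⟪nC, nN⟫ = 0 := hCN
  have i6 : ⟪nC * nN, nN⟫ = 0 := inner_pure_mul_right hC0 hN0
  have e1 := congrArg (fun q : ℍ => ⟪q, nC * nN⟫) hconj
  have e2 := congrArg (fun q : ℍ => ⟪q, nN⟫) hconj
  have icoe : ∀ (u : ℝ) (q : ℍ), ⟪(u : ℍ), q⟫ = u * q.re := fun u q => by rw [Quaternion.inner_def]; simp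
  simp only [inner_add_left, inner_smul_left, icoe, hX0, hN0, i1, i2, i3, i4, i5, i6,
    RCLike.conj_to_real, mul_zero, mul_one, zero_add, add_zero] at e1 e2
  have hyN : yN ≠ 0 := by rintro rfl; simp at hpos
  have hab : α * β = 0 := by
    have : yN * (2 * α * β) = 0 := by linarith
    rcases mul_eq_zero.mp this with h | h
    · exact absurd h hyN
    · linarith
  have hsq : 0 < α ^ 2 - β ^ 2 := by
    have h1 : yN * ((α ^ 2 - β ^ 2) * yN) = yN * yN' := by rw [← e2]; ring
    nlinarith [sq_nonneg yN, hpos]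
  have hβ : β = 0 := by
    rcases mul_eq_zero.mp hab with h | h
    · exfalso; rw [h] at hsq; nlinarith [sq_nonneg β]
    · exact h
  have hα : α = 1 ∨ α = -1 := by
    rw [hβ] at hαβ
    have : (α - 1) * (α + 1) = 0 := by nlinarith
    rcases mul_eq_zero.mp this with h | h
    · left; linarith
    · right; linarith
  rw [hβ, zero_smul, add_zero] at hkdec
  rcases hα with h | h
  · left; rw [hkdec, h]; simp
  · right; rw [hkdec, h]; simp

/-! ## §3 The anchors in exponential coordinates -/

/-- **The seam-anchor equation alone forces `k` to commute with `n_C`**: if `k (a + c n_C) k* = a' + c' n_C` with `c, c' > 0` and `‖k‖ = 1`, then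
`k n_C = n_C k` (real parts give `a = a'`, norms give `c = c'`). [folklore] -/
theorem commute_of_conj_span {nC k : ℍ} (hC0 : nC.re = 0) (hC1 : ‖nC‖ = 1) (hk : ‖k‖ = 1) {a c a' c' : ℝ} (hc : 0 < c) (hc' : 0 < c')
    (h : k * ((a : ℍ) + c • nC) * star k = (a' : ℍ) + c' • nC) : k * nC = nC * k := by
  have hkk : k * star k = 1 := by
    rw [Quaternion.self_mul_star k, Quaternion.normSq_eq_norm_mul_self, hk]; norm_num
  have hkk' : star k * k = 1 := by
    rw [Quaternion.star_mul_self k, Quaternion.normSq_eq_norm_mul_self, hk]; norm_num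
  -- k (a + c nC) k* = a + c (k nC k*)
  have hL : k * ((a : ℍ) + c • nC) * star k = (a : ℍ) + c • (k * nC * star k) := by
    rw [mul_add, add_mul, ← Quaternion.coe_commutes a k, mul_assoc (a : ℍ), hkk, mul_one, mul_smul_comm, smul_mul_assoc]
  rw [hL] at h
  -- real parts: a = a'
  have hre : (k * nC * star k).re = 0 := by
    rw [show (k * nC * star k).re = (star k * (k * nC)).re by simp only [Quaternion.re_mul]; ring, ← mul_assoc, hkk',
      one_mul, hC0]
  have ha : a = a' := by
    have := congrArg (fun q : ℍ => q.re) h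
    simpa [hre, hC0] using this
  rw [ha, add_right_inj] at h
  -- norms: c = c'
  have hnorm : ‖k * nC * star k‖ = 1 := by
    rw [norm_mul, norm_mul, norm_star, hk, hC1]; norm_num
  have hcc : c = c' := by
    have := congrArg (fun q : ℍ => ‖q‖) h
    simp only [norm_smul, hnorm, hC1, mul_one, Real.norm_eq_abs, abs_of_pos hc, abs_of_pos hc'] at this
    exact this
  rw [hcc] at h
  have hconj : k * nC * star k = nC := smul_right_injective ℍ hc'.ne' h
  calc k * nC = k * nC * (star k * k) := by rw [hkk', mul_one]
    _ = (k * nC * star k) * k := by simp only [mul_assoc]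
    _ = nC * k := by rw [hconj]

/-- The seam anchor in exponential coordinates: `e^{ι(t ω)} · ιω = −sin t + cos t · ιω` for a unit vector `ω`. [folklore] -/
theorem exp_smul_mul_self {ω : EuclideanSpace ℝ (Fin 3)} (hω : ‖ω‖ = 1) (t : ℝ) :
    exp (imQuat (t • ω)) * imQuat ω = ((-Real.sin t : ℝ) : ℍ) + Real.cos t • imQuat ω := by
  have hn0 : (imQuat ω).re = 0 := imQuat_re ω
  have hn1 : ‖imQuat ω‖ = 1 := by rw [norm_imQuat, hω]
  have hnn : imQuat ω * imQuat ω = -1 := by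
    have hns : (imQuat ω).re ^ 2 + (imQuat ω).imI ^ 2 + (imQuat ω).imJ ^ 2 + (imQuat ω).imK ^ 2 = 1 := by
      rw [← sq_norm_eq_sum_sq, hn1]; norm_num
    ext <;> simp [imQuat_apply] at hns ⊢ <;> nlinarith [hns]
  rw [exp_imQuat_smul hω, add_mul, smul_mul_assoc, hnn, Quaternion.coe_mul_eq_smul]
  rw [smul_neg, ← neg_smul, add_comm]
  congr 1
  rw [Quaternion.coe_neg, ← Quaternion.coe_neg]
  simp [Algebra.smul_def]

/-- The link anchor in exponential coordinates: for `b = b₁ω_N + b₂ω_×` with `ιω_× = ιω_C·ιω_N` (`ω_C ⊥ ω_N` unit vectors),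
`e^{ι b} · ιω_N = −sinc‖b‖·b₁ − sinc‖b‖·b₂ · ιω_C + cos‖b‖ · ιω_N`. [folklore] -/
theorem exp_perp_mul_anchor {ωC ωN ωX : EuclideanSpace ℝ (Fin 3)} (hC : ‖ωC‖ = 1) (hN : ‖ωN‖ = 1) (hCN : ⟪ωC, ωN⟫ = 0)
    (hX : imQuat ωX = imQuat ωC * imQuat ωN) (b₁ b₂ : ℝ) :
    exp (imQuat (b₁ • ωN + b₂ • ωX)) * imQuat ωN =
      ((-(Real.sinc ‖b₁ • ωN + b₂ • ωX‖ * b₁) : ℝ) : ℍ) + (-(Real.sinc ‖b₁ • ωN + b₂ • ωX‖ * b₂)) • imQuat ωC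
        + Real.cos ‖b₁ • ωN + b₂ • ωX‖ • imQuat ωN := by
  set r := ‖b₁ • ωN + b₂ • ωX‖ with hr
  have hC0 : (imQuat ωC).re = 0 := imQuat_re ωC
  have hN0 : (imQuat ωN).re = 0 := imQuat_re ωN
  have hC1 : ‖imQuat ωC‖ = 1 := by rw [norm_imQuat, hC]
  have hN1 : ‖imQuat ωN‖ = 1 := by rw [norm_imQuat, hN]
  have hCN' : ⟪imQuat ωC, imQuat ωN⟫ = 0 := by
    rw [Quaternion.inner_def]; simp [imQuat_apply]
    have : ⟪ωC, ωN⟫ = ∑ i, ωC i * ωN i := by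
      rw [real_inner_comm, PiLp.inner_apply]; simp
    rw [this, Fin.sum_univ_three] at hCN
    linarith
  have hNN : imQuat ωN * imQuat ωN = -1 := by
    have hns : (imQuat ωN).re ^ 2 + (imQuat ωN).imI ^ 2 + (imQuat ωN).imJ ^ 2 + (imQuat ωN).imK ^ 2 = 1 := by
      rw [← sq_norm_eq_sum_sq, hN1]; norm_num
    ext <;> simp [imQuat_apply] at hns ⊢ <;> nlinarith [hns]
  have hXN : imQuat ωC * imQuat ωN * imQuat ωN = -imQuat ωC := by rw [mul_assoc, hNN, mul_neg_one]
  rw [exp_imQuat, map_add, map_smul, map_smul, hX, add_mul, smul_mul_assoc, add_mul, smul_mul_assoc, smul_mul_assoc, hNN, hXN,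
    Quaternion.coe_mul_eq_smul]
  -- bookkeeping of scalars
  rw [smul_add, smul_smul, smul_smul, smul_neg, smul_neg, ← neg_smul, ← neg_smul]
  have e : (-(Real.sinc r * b₁)) • (1 : ℍ) = (((-(Real.sinc r * b₁)) : ℝ) : ℍ) := by
    rw [Algebra.smul_def, mul_one]; rfl
  rw [← e]
  module

/-! ## §4 The two-anchor slice property -/

/-- ★★ **THE TWO-ANCHOR SLICE PROPERTY (quaternions).**  Let `ω_C ⊥ ω_N` be unit vectors of `ℝ³`, `ιω_× = ιω_C ιω_N`, `N₀ = ±ιω_N`, and `k` a unit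
quaternion.  If `k · e^{ι(tω_C)}ιω_C · k* = e^{ι(t'ω_C)}ιω_C` with `|t|, |t'| < π/2` and
`k · e^{ι(b₁ω_N + b₂ω_×)}N₀ · k* = e^{ι(b₁'ω_N + b₂'ω_×)}N₀` with `b₁² + b₂², b₁'² + b₂'² < (π/2)²`, then `k = ±1`.
[cite: GonzalezarroyoAltes1988, §2] [cite: Bredon1972, Ch. II §§4–5] -/
theorem eq_one_or_neg_one_of_conj_anchor_pair {ωC ωN ωX : EuclideanSpace ℝ (Fin 3)} (hC : ‖ωC‖ = 1) (hN : ‖ωN‖ = 1)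
    (hCN : ⟪ωC, ωN⟫ = 0) (hX : imQuat ωX = imQuat ωC * imQuat ωN) {N₀ : ℍ} (hN₀ : N₀ = imQuat ωN ∨ N₀ = -imQuat ωN)
    {k : ℍ} (hk : ‖k‖ = 1) {t t' b₁ b₂ b₁' b₂' : ℝ} (ht : |t| < Real.pi / 2) (ht' : |t'| < Real.pi / 2)
    (hb : b₁ ^ 2 + b₂ ^ 2 < (Real.pi / 2) ^ 2) (hb' : b₁' ^ 2 + b₂' ^ 2 < (Real.pi / 2) ^ 2)
    (h1 : k * (exp (imQuat (t • ωC)) * imQuat ωC) * star k = exp (imQuat (t' • ωC)) * imQuat ωC)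
    (h2 : k * (exp (imQuat (b₁ • ωN + b₂ • ωX)) * N₀) * star k = exp (imQuat (b₁' • ωN + b₂' • ωX)) * N₀) :
    k = 1 ∨ k = -1 := by
  have hC0 : (imQuat ωC).re = 0 := imQuat_re ωC
  have hN0 : (imQuat ωN).re = 0 := imQuat_re ωN
  have hC1 : ‖imQuat ωC‖ = 1 := by rw [norm_imQuat, hC]
  have hN1 : ‖imQuat ωN‖ = 1 := by rw [norm_imQuat, hN]
  have hCN' : ⟪imQuat ωC, imQuat ωN⟫ = 0 := by
    rw [Quaternion.inner_def]; simp [imQuat_apply]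
    have : ⟪ωC, ωN⟫ = ∑ i, ωC i * ωN i := by
      rw [real_inner_comm, PiLp.inner_apply]; simp
    rw [this, Fin.sum_univ_three] at hCN
    linarith
  -- step 1: the seam anchor forces `k n_C = n_C k`
  rw [exp_smul_mul_self hC t, exp_smul_mul_self hC t'] at h1
  have hcos : 0 < Real.cos t := Real.cos_pos_of_mem_Ioo ⟨by linarith [abs_lt.mp ht], by linarith [abs_lt.mp ht]⟩
  have hcos' : 0 < Real.cos t' := Real.cos_pos_of_mem_Ioo ⟨by linarith [abs_lt.mp ht'], by linarith [abs_lt.mp ht']⟩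
  have hkC : k * imQuat ωC = imQuat ωC * k := commute_of_conj_span hC0 hC1 hk hcos hcos' h1
  -- step 2: the link anchor in the form `y₀ + y_C n_C + y_N n_N`
  -- norms of the slice coordinates
  have hX0 : (imQuat ωX).re = 0 := imQuat_re ωX
  have hX1 : ‖ωX‖ = 1 := by rw [← norm_imQuat, hX, norm_mul, hC1, hN1, mul_one]
  have hNX : ⟪ωN, ωX⟫ = 0 := by
    have h := inner_pure_mul_right hC0 hN0
    rw [← hX, real_inner_comm, Quaternion.inner_def] at h
    simp [imQuat_apply] at h
    rw [real_inner_comm, PiLp.inner_apply]; simp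
    rw [Fin.sum_univ_three]; linarith
  have hnorm : ∀ c₁ c₂ : ℝ, ‖c₁ • ωN + c₂ • ωX‖ ^ 2 = c₁ ^ 2 + c₂ ^ 2 := by
    intro c₁ c₂
    rw [@norm_add_sq_real, norm_smul, norm_smul, hN, hX1, mul_one, mul_one, inner_smul_left, inner_smul_right, hNX,
      Real.norm_eq_abs, Real.norm_eq_abs, sq_abs, sq_abs]
    simp
  have hcosb : 0 < Real.cos ‖b₁ • ωN + b₂ • ωX‖ := by
    have hlt : ‖b₁ • ωN + b₂ • ωX‖ < Real.pi / 2 := by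
      have h := hnorm b₁ b₂
      nlinarith [norm_nonneg (b₁ • ωN + b₂ • ωX), Real.pi_pos]
    exact Real.cos_pos_of_mem_Ioo ⟨by linarith [norm_nonneg (b₁ • ωN + b₂ • ωX), Real.pi_pos], hlt⟩
  have hcosb' : 0 < Real.cos ‖b₁' • ωN + b₂' • ωX‖ := by
    have hlt : ‖b₁' • ωN + b₂' • ωX‖ < Real.pi / 2 := by
      have h := hnorm b₁' b₂'
      nlinarith [norm_nonneg (b₁' • ωN + b₂' • ωX), Real.pi_pos]
    exact Real.cos_pos_of_mem_Ioo ⟨by linarith [norm_nonneg (b₁' • ωN + b₂' • ωX), Real.pi_pos], hlt⟩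
  -- the sign ε of N₀
  obtain ⟨ε, hε1, hNε⟩ : ∃ ε : ℝ, ε ^ 2 = 1 ∧ N₀ = ε • imQuat ωN := by
    rcases hN₀ with h | h
    · exact ⟨1, by norm_num, by rw [h, one_smul]⟩
    · exact ⟨-1, by norm_num, by rw [h, neg_one_smul]⟩
  set r := ‖b₁ • ωN + b₂ • ωX‖ with hr
  set r' := ‖b₁' • ωN + b₂' • ωX‖ with hr'
  -- rewrite both anchor values as y₀ + yC nC + yN nN
  have hform : ∀ (u v w : ℝ), ε • (((u : ℝ) : ℍ) + v • imQuat ωC + w • imQuat ωN) =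
      (((ε * u : ℝ) : ℍ)) + (ε * v) • imQuat ωC + (ε * w) • imQuat ωN := by
    intro u v w
    rw [smul_add, smul_add, smul_smul, smul_smul, ← Quaternion.coe_mul_eq_smul, ← Quaternion.coe_mul]
  have hY : exp (imQuat (b₁ • ωN + b₂ • ωX)) * N₀ =
      (((ε * -(Real.sinc r * b₁) : ℝ) : ℍ)) + (ε * -(Real.sinc r * b₂)) • imQuat ωC + (ε * Real.cos r) • imQuat ωN := by
    rw [hNε, mul_smul_comm, exp_perp_mul_anchor hC hN hCN hX, hform]
  have hY' : exp (imQuat (b₁' • ωN + b₂' • ωX)) * N₀ =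
      (((ε * -(Real.sinc r' * b₁') : ℝ) : ℍ)) + (ε * -(Real.sinc r' * b₂')) • imQuat ωC + (ε * Real.cos r') • imQuat ωN := by
    rw [hNε, mul_smul_comm, exp_perp_mul_anchor hC hN hCN hX, hform]
  rw [hY, hY'] at h2
  refine eq_one_or_neg_one_of_conj_anchors hC0 hC1 hN0 hN1 hCN' hk hkC ?_ h2
  have : 0 < Real.cos r * Real.cos r' := mul_pos hcosb hcosb'
  calc (0 : ℝ) < Real.cos r * Real.cos r' := this
    _ = ε * Real.cos r * (ε * Real.cos r') := by linear_combination (-(Real.cos r * Real.cos r')) * hε1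

/-- ★★ **THE TWO-ANCHOR SLICE PROPERTY in `SU(2)`** (the `hslice` input, decided on the two anchor components of `Q_s`): with
`su2Quat C₀ = ιω_C`, `su2Quat N₀ = ±ιω_N` (`ω_C ⊥ ω_N` unit vectors, `ιω_× = ιω_C ιω_N`), `k : SU2`, and the two anchor equations in `SU(2)`
(`expPoint` = the exponential chart), `k = 1` or `k = negOne`. [cite: GonzalezarroyoAltes1988, §2] [cite: Bredon1972, Ch. II §§4–5] -/
theorem su2_eq_one_or_negOne_of_conj_anchor_pair {ωC ωN ωX : EuclideanSpace ℝ (Fin 3)} (hC : ‖ωC‖ = 1) (hN : ‖ωN‖ = 1)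
    (hCN : ⟪ωC, ωN⟫ = 0) (hX : imQuat ωX = imQuat ωC * imQuat ωN) {C₀ N₀ : SU2} (hC₀ : su2Quat C₀ = imQuat ωC)
    (hN₀ : su2Quat N₀ = imQuat ωN ∨ su2Quat N₀ = -imQuat ωN)
    (k : SU2) {t t' b₁ b₂ b₁' b₂' : ℝ} (ht : |t| < Real.pi / 2) (ht' : |t'| < Real.pi / 2)
    (hb : b₁ ^ 2 + b₂ ^ 2 < (Real.pi / 2) ^ 2) (hb' : b₁' ^ 2 + b₂' ^ 2 < (Real.pi / 2) ^ 2)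
    (h1 : k * (expPoint (t • ωC) * C₀) * k⁻¹ = expPoint (t' • ωC) * C₀)
    (h2 : k * (expPoint (b₁ • ωN + b₂ • ωX) * N₀) * k⁻¹ = expPoint (b₁' • ωN + b₂' • ωX) * N₀) :
    k = 1 ∨ k = negOne := by
  have hk : ‖su2Quat k‖ = 1 := norm_su2Quat k
  have h1' := congrArg su2Quat h1
  have h2' := congrArg su2Quat h2
  simp only [Literature.MathematicalPhysics.QuantumFieldTheory.Balaban1983to89.T4HaarSU2Translate.su2Quat_mul, su2Quat_inv,
    su2Quat_expPoint, hC₀] at h1' h2'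
  have h := eq_one_or_neg_one_of_conj_anchor_pair hC hN hCN hX hN₀ hk ht ht' hb hb' h1' h2'
  rcases h with h | h
  · left; exact su2Quat_injective (by rw [h, su2Quat_one])
  · right; exact su2Quat_injective (by rw [h, su2Quat_negOne])

end Summit.QuantumFields.YangMills.Theorems.VirialFluxGap.AnchorSlice

end
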